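import Literature.NumberTheory.LFunctions.QuadraticCharacterDivisorSumHarmonic
import Literature.NumberTheory.LFunctions.DirichletConvOneChiSum
import Literature.NumberTheory.Sieve.PolyaVinogradovNonprincipal
import Mathlib.NumberTheory.Harmonic.Bounds
import HarnessLib

/-!
# Montgomery–Vaughan I, §11.2.1 Exercise 3(g) — proof
# `Σ_{n ≤ x} r(n)/n = (log x + C₀)L(1,χ) + L′(1,χ) + O(q^{1/4} x^{−1/2} (log qx)^{3/2})`

Topic `Literature/NumberTheory/LFunctions`, namespace `Literature.NumberTheory.LFunctions`
(helpers in `MontgomeryVaughan2007Ex3`). THEOREMS ONLY (no definitions, no named facts, no new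
hypotheses). This file DISCHARGES the named fact `montgomeryVaughan2007_ex11_2_1_3g` of
`QuadraticCharacterDivisorSumHarmonic.lean` (Montgomery–Vaughan, *Multiplicative Number Theory I*,
§11.2.1 Exercise 3(g), p. 286; after Mahler 1934, Davenport 1966, Haneke 1973, Goldfeld–Schinzel 1975):
`montgomeryVaughan2007_ex11_2_1_3g_holds`, for EVERY real `x ≥ 1` and every non-principal (quadratic)
character `χ` mod `q`, with `c = 500`.

## The printed road (Exercise 3 (a)–(g), p. 286) and what is proved

The exercise is the hyperbola method: (c) `Σ_{n≤x} r(n)/n = Σ₁ + Σ₂ − Σ₃` with a parameter `y`,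
(a),(b) the tails `Σ_{n≤y} χ(n)/n = L(1,χ) + O(q^{1/2}y^{−1} log q)`,
`Σ_{n≤y} χ(n) log n/n = −L′(1,χ) + O(q^{1/2}y^{−1}(log qy)²)` by partial summation from
Pólya–Vinogradov, (d)–(f) the three pieces, (g) the choice `y ≍ q^{1/4}x^{1/2}(log qx)^{·}`.
The tree already holds (a)–(f) as theorems for an ARBITRARY bound `B` on the character sums
(`DirichletConvOneChiSum.lean`: `DirichletAbel.norm_sum_divisorSum_div_sub_le`,
`|Σ_{n≤N} r(n)/n − ((log N + γ)L(1,χ) + L′(1,χ))| ≤ 8B(log N + 1)/(Y + 1) + 4Y/N` for `2 ≤ Y ≤ N`)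
and Pólya–Vinogradov for every non-principal character (`polyaVinogradov_of_ne_one`, MV Thm 9.18;
here rounded to `B = 8√q(1 + log q)`, `norm_partialSum_le_pv`). Two points need care to get (g) for
ALL `x ≥ 1`:

1. **Long range** `N ≥ B(1 + log N)`: the tree's estimate with `Y = ⌊√(BN(1 + log N))⌋ ≤ N` gives
   `≤ 12√(B(1 + log N)/N)`.
2. **Short range** `N < B(1 + log N)` (i.e. `x ≲ √q log²q`), where the balancing `y` of (g) exceeds
   `x`: the decomposition (c) is used with `y > x`, so that `Σ₂ = Σ₃ = 0` and the head is the whole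
   sum — `Σ_{n≤N} r(n)/n = Σ_{d≤Y} (χ(d)/d) H(⌊N/d⌋)` for any `Y ≥ N` (`sum_divisorSum_div_eq_of_le`),
   with `|H(⌊N/d⌋) − (log(N/d) + γ)| ≤ 4d/N` for `d ≤ N` and `≤ log(d/N) + γ` for `N < d ≤ Y`
   (`norm_sub_head_le_of_le`: error `4 + (1 + log(Y/N))²`); then (a),(b) at `Y = N + ⌈B(1 + log qN)⌉`
   (`norm_sub_main_le_of_le`) and `(1 + log u)² ≤ 16√u`.

Both ranges give `√N·|error| ≤ 320 q^{1/4} log(qN)` (`norm_sub_main_mul_sqrt_le`); the passage from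
`N = ⌊x⌋` to real `x` costs `|log x − log N|·|L(1,χ)| ≤ (3 + log q)/N`
(`norm_LFunction_one_le_log`: `|L(1,χ)| ≤ 3 + log q` for every non-principal `χ`, Exercise 3(a) with
the trivial bound `|Σ_{n≤N} χ(n)| ≤ q`). The result is in fact
`|…| ≤ 500 q^{1/4} x^{−1/2} log(qx)` (`abs_sum_rDivisorSum_div_sub_le`, every non-principal `χ`, every
real `x ≥ 1`) `≤ 500 q^{1/4} x^{−1/2} (log qx)^{3/2}` (`log qx ≥ 1`); the hypothesis "quadratic" of the
named fact is not used (the real parts are taken termwise).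

## References

* [MontgomeryVaughan2007] H. L. Montgomery, R. C. Vaughan, *Multiplicative Number Theory I. Classical
  Theory*, Cambridge Studies in Advanced Mathematics 97, CUP 2007, §11.2.1 Exercise 3 (a)–(g), p. 286
  [held: book:montgomery2007-multiplicative-number-theory-i-classical-theory p0286]; §9.4 Theorem 9.18.
* [GoldfeldSchinzel1975] D. M. Goldfeld, A. Schinzel, *On Siegel's zero*, Ann. Scuola Norm. Sup. Pisa
  (4) 2 (1975) 571–583, Lemma 1 (the source of (g)).
-/

noncomputable section

open Finset Complex

namespace Literature.NumberTheory.LFunctions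

namespace MontgomeryVaughan2007Ex3

variable {q : ℕ} [NeZero q] (χ : DirichletCharacter ℂ q)

/-- A non-principal character has modulus `q ≥ 3` (every character mod `1` or `2` is principal).
[folklore] -/
private theorem three_le (hχ : χ ≠ 1) : 3 ≤ q := by
  have h0 : q ≠ 0 := NeZero.ne q
  have h1 : q ≠ 1 := by
    rintro rfl
    exact hχ (DirichletCharacter.level_one χ)
  have h2 : q ≠ 2 := by
    rintro rfl
    exact hχ (MulChar.ext fun u => by rw [Subsingleton.elim u 1]; simp)
  omega

/-- **Pólya–Vinogradov for the partial sums of a non-principal character**, in the rounded form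
`|Σ_{n ≤ N} χ(n)| ≤ 8√q(1 + log q)` (from the tree's explicit MV Theorem 9.18,
`polyaVinogradov_of_ne_one`: `(4/π²)√q log q + (8/π²)√q log log q + (15/2)√q`).
[cite: MontgomeryVaughan2007, §9.4 Theorem 9.18] -/
theorem norm_partialSum_le_pv (hχ : χ ≠ 1) (N : ℕ) :
    ‖DirichletAbel.partialSum χ N‖ ≤ 8 * (Real.sqrt q * (1 + Real.log q)) := by
  have hq3 : (3 : ℝ) ≤ q := by exact_mod_cast three_le χ hχ
  have h := Literature.NumberTheory.Sieve.LargeSieve.polyaVinogradov_of_ne_one hχ 0 N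
  rw [← DirichletAbel.partialSum_eq_sum_Ioc] at h
  refine h.trans ?_
  have hsq : 0 ≤ Real.sqrt q := Real.sqrt_nonneg _
  have hlogq : 1 ≤ Real.log q := by
    rw [← Real.log_exp 1]
    refine Real.log_le_log (Real.exp_pos 1) (le_trans ?_ hq3)
    have := Real.exp_one_lt_d9; norm_num at this; linarith
  have hll : Real.log (Real.log q) ≤ Real.log q :=
    (Real.log_le_sub_one_of_pos (by linarith)).trans (by linarith)
  have hll0 : 0 ≤ Real.log (Real.log q) := Real.log_nonneg hlogq
  have hπ : (9 : ℝ) ≤ Real.pi ^ 2 := by nlinarith [Real.pi_gt_three]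
  have h4 : 4 / Real.pi ^ 2 ≤ (1 : ℝ) / 2 := by
    rw [div_le_div_iff₀ (by positivity) (by norm_num)]; linarith
  have h8 : 8 / Real.pi ^ 2 ≤ (1 : ℝ) := by
    rw [div_le_one (by positivity)]; linarith
  calc 4 / Real.pi ^ 2 * Real.sqrt q * Real.log q + 8 / Real.pi ^ 2 * Real.sqrt q * Real.log (Real.log q) +
        15 / 2 * Real.sqrt q
      ≤ 1 / 2 * Real.sqrt q * Real.log q + 1 * Real.sqrt q * Real.log q + 15 / 2 * Real.sqrt q := by
        gcongr
    _ = Real.sqrt q * (3 / 2 * Real.log q + 15 / 2) := by ring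
    _ ≤ Real.sqrt q * (8 * (1 + Real.log q)) := by gcongr; linarith
    _ = 8 * (Real.sqrt q * (1 + Real.log q)) := by ring

/-- **`|L(1,χ)| ≤ 3 + log q` for non-principal `χ` mod `q`** (Exercise 3(a) with the trivial partial-sum
bound `|Σ_{n≤N} χ(n)| ≤ q` at `M = q`: `|Σ_{d ≤ q} χ(d)/d − L(1,χ)| ≤ 2q/(q+1) ≤ 2` and
`|Σ_{d ≤ q} χ(d)/d| ≤ H(q) ≤ 1 + log q`). [cite: MontgomeryVaughan2007, §11.2.1 Exercise 3(a)] -/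
theorem norm_LFunction_one_le_log (hχ : χ ≠ 1) : ‖χ.LFunction 1‖ ≤ 3 + Real.log q := by
  have hq0 : (0 : ℝ) < q := by exact_mod_cast NeZero.pos q
  have h1 := DirichletAbel.norm_sum_Icc_div_sub_LFunction_one_le χ hχ
    (DirichletAbel.norm_partialSum_le χ hχ) q
  have h2 : ‖∑ d ∈ Icc 1 q, χ (d : ZMod q) / (d : ℂ)‖ ≤ 1 + Real.log q := by
    refine (norm_sum_le _ _).trans ?_
    have hterm : ∀ d ∈ Icc 1 q, ‖χ (d : ZMod q) / (d : ℂ)‖ ≤ (d : ℝ)⁻¹ := by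
      intro d hd
      rw [mem_Icc] at hd
      have hd0 : (0 : ℝ) < d := by exact_mod_cast hd.1
      rw [norm_div, Complex.norm_natCast, div_le_iff₀ hd0, inv_mul_cancel₀ hd0.ne']
      exact χ.norm_le_one _
    refine (sum_le_sum hterm).trans ?_
    have := harmonic_le_one_add_log q
    rw [harmonic_eq_sum_Icc] at this
    push_cast at this
    exact this
  have h3 : 2 * (q : ℝ) / ((q : ℝ) + 1) ≤ 2 := by
    rw [div_le_iff₀ (by positivity)]; linarith
  calc ‖χ.LFunction 1‖
      = ‖(∑ d ∈ Icc 1 q, χ (d : ZMod q) / (d : ℂ)) -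
          ((∑ d ∈ Icc 1 q, χ (d : ZMod q) / (d : ℂ)) - χ.LFunction 1)‖ := by ring_nf
    _ ≤ ‖∑ d ∈ Icc 1 q, χ (d : ZMod q) / (d : ℂ)‖ +
          ‖(∑ d ∈ Icc 1 q, χ (d : ZMod q) / (d : ℂ)) - χ.LFunction 1‖ := norm_sub_le _ _
    _ ≤ (1 + Real.log q) + 2 := add_le_add h2 (h1.trans h3)
    _ = 3 + Real.log q := by ring

omit [NeZero q] in
/-- `(1 + log u)² ≤ 16 √u` for `u ≥ 1` (with `w = u^{1/4}`: `log u = 4 log w ≤ 4(w − 1)`). [folklore] -/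
private theorem one_add_log_sq_le {u : ℝ} (hu : 1 ≤ u) :
    (1 + Real.log u) ^ 2 ≤ 16 * Real.sqrt u := by
  set w := Real.sqrt (Real.sqrt u) with hw
  have hu0 : 0 ≤ u := by linarith
  have hw0 : 0 < w := Real.sqrt_pos.mpr (Real.sqrt_pos.mpr (by linarith))
  have hw2 : w ^ 2 = Real.sqrt u := Real.sq_sqrt (Real.sqrt_nonneg u)
  have hw4 : w ^ 4 = u := by
    rw [show w ^ 4 = (w ^ 2) ^ 2 by ring, hw2, Real.sq_sqrt hu0]
  have hlog : Real.log u = 4 * Real.log w := by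
    rw [← hw4, Real.log_pow]; push_cast; ring
  have hw1 : 1 ≤ w := by
    by_contra h
    have h' : w < 1 := lt_of_not_ge h
    have : w ^ 4 < 1 := by
      calc w ^ 4 < 1 ^ 4 := by gcongr
        _ = 1 := by norm_num
    linarith
  have hlw : Real.log w ≤ w - 1 := Real.log_le_sub_one_of_pos hw0
  have hlw0 : 0 ≤ Real.log w := Real.log_nonneg hw1
  have h1 : 0 ≤ 1 + Real.log u := by rw [hlog]; positivity
  have h2 : 1 + Real.log u ≤ 4 * w := by rw [hlog]; linarith
  calc (1 + Real.log u) ^ 2 ≤ (4 * w) ^ 2 := by gcongr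
    _ = 16 * Real.sqrt u := by rw [← hw2]; ring


/-! ### The head sum taken beyond `x`: `y ≥ x` (Exercise 3(c)–(d) with `Σ₂ = Σ₃ = 0`) -/

omit [NeZero q] in
/-- The hyperbola identity with the `d`-sum extended to `d ≤ Y`, `Y ≥ N`: the extra terms vanish
(`H(⌊N/d⌋) = H(0) = 0` for `d > N`). [cite: MontgomeryVaughan2007, §11.2.1 Exercise 3(c)] -/
theorem sum_divisorSum_div_eq_of_le {N Y : ℕ} (hNY : N ≤ Y) :
    ∑ n ∈ Icc 1 N, (∑ d ∈ n.divisors, χ (d : ZMod q)) / (n : ℂ) =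
      ∑ d ∈ Icc 1 Y, χ (d : ZMod q) / (d : ℂ) * ((harmonic (N / d) : ℝ) : ℂ) := by
  rw [DirichletAbel.sum_divisorSum_div_eq χ N]
  refine Finset.sum_subset (fun d hd => ?_) fun d hdY hdN => ?_
  · rw [mem_Icc] at hd ⊢; exact ⟨hd.1, hd.2.trans hNY⟩
  · rw [mem_Icc] at hdY hdN
    have hlt : N < d := by omega
    rw [Nat.div_eq_of_lt hlt, harmonic_zero]
    simp

omit [NeZero q] in
/-- `Σ_{N < d ≤ Y} 1/d = H(Y) − H(N) ≤ 1 + log(Y/N)` for `1 ≤ N ≤ Y`. [folklore] -/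
private theorem sum_inv_Icc_le {N Y : ℕ} (hN : 1 ≤ N) (hNY : N ≤ Y) :
    ∑ d ∈ Icc (N + 1) Y, (1 : ℝ) / d ≤ 1 + Real.log ((Y : ℝ) / N) := by
  have hN0 : (0 : ℝ) < N := by exact_mod_cast hN
  have hY0 : (0 : ℝ) < Y := by exact_mod_cast (hN.trans hNY)
  have hsplit : ∑ d ∈ Icc 1 Y, (1 : ℝ) / d = ∑ d ∈ Icc 1 N, (1 : ℝ) / d + ∑ d ∈ Icc (N + 1) Y, (1 : ℝ) / d := by
    have e1 : Icc 1 Y = Ico 1 (Y + 1) := by ext n; simp only [mem_Icc, mem_Ico]; omega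
    have e2 : Icc 1 N = Ico 1 (N + 1) := by ext n; simp only [mem_Icc, mem_Ico]; omega
    have e3 : Icc (N + 1) Y = Ico (N + 1) (Y + 1) := by ext n; simp only [mem_Icc, mem_Ico]; omega
    rw [e1, e2, e3, Finset.sum_Ico_consecutive _ (by omega) (by omega)]
  have hHY : ∑ d ∈ Icc 1 Y, (1 : ℝ) / d = (harmonic Y : ℝ) := by
    rw [harmonic_eq_sum_Icc]; push_cast
    exact Finset.sum_congr rfl fun d _ => one_div _
  have hHN : ∑ d ∈ Icc 1 N, (1 : ℝ) / d = (harmonic N : ℝ) := by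
    rw [harmonic_eq_sum_Icc]; push_cast
    exact Finset.sum_congr rfl fun d _ => one_div _
  have h1 := harmonic_le_one_add_log Y
  have h2 := log_add_one_le_harmonic N
  have h3 : Real.log N ≤ Real.log ((N + 1 : ℕ) : ℝ) :=
    Real.log_le_log hN0 (by push_cast; linarith)
  rw [Real.log_div hY0.ne' hN0.ne']
  linarith

omit [NeZero q] in
/-- **The head `Σ_{d ≤ y} (χ(d)/d) H(⌊x/d⌋)` for `y ≥ x`** (Exercise 3(d) without the restriction
`y ≤ x`): for `1 ≤ N ≤ Y`,
`|Σ_{n ≤ N} r(n)/n − ((log N + γ)Σ_{d ≤ Y} χ(d)/d − Σ_{d ≤ Y} χ(d) log d/d)| ≤ 4 + (1 + log(Y/N))²`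
(`|H(⌊N/d⌋) − (log N − log d + γ)| ≤ 4d/N` for `d ≤ N`, `≤ log(d/N) + γ` for `N < d ≤ Y`, and
`Σ_{N<d≤Y} 1/d ≤ 1 + log(Y/N)`). [cite: MontgomeryVaughan2007, §11.2.1 Exercise 3(d)] -/
theorem norm_sub_head_le_of_le {N Y : ℕ} (hN : 1 ≤ N) (hNY : N ≤ Y) :
    ‖(∑ n ∈ Icc 1 N, (∑ d ∈ n.divisors, χ (d : ZMod q)) / (n : ℂ)) -
        ((Real.log N + Real.eulerMascheroniConstant : ℝ) * ∑ d ∈ Icc 1 Y, χ (d : ZMod q) / (d : ℂ) -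
          ∑ d ∈ Icc 1 Y, χ (d : ZMod q) * ((Real.log d / d : ℝ) : ℂ))‖ ≤
      4 + (1 + Real.log ((Y : ℝ) / N)) ^ 2 := by
  have hN0 : (0 : ℝ) < N := by exact_mod_cast hN
  have hY0 : (0 : ℝ) < Y := by exact_mod_cast (hN.trans hNY)
  have hγ0 : 0 ≤ Real.eulerMascheroniConstant :=
    (by norm_num : (0 : ℝ) ≤ 1 / 2).trans Real.one_half_lt_eulerMascheroniConstant.le
  have hγ1 : Real.eulerMascheroniConstant ≤ 1 :=
    (Real.eulerMascheroniConstant_lt_two_thirds.le).trans (by norm_num)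
  have hlogYN : 0 ≤ Real.log ((Y : ℝ) / N) :=
    Real.log_nonneg ((one_le_div hN0).mpr (by exact_mod_cast hNY))
  -- the difference, termwise
  set T : ℕ → ℂ := fun d => χ (d : ZMod q) / (d : ℂ) *
    (((harmonic (N / d) : ℝ) : ℂ) - ((Real.log N - Real.log d + Real.eulerMascheroniConstant : ℝ) : ℂ))
    with hT
  have hdiff : (∑ n ∈ Icc 1 N, (∑ d ∈ n.divisors, χ (d : ZMod q)) / (n : ℂ)) -
      ((Real.log N + Real.eulerMascheroniConstant : ℝ) * ∑ d ∈ Icc 1 Y, χ (d : ZMod q) / (d : ℂ) -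
        ∑ d ∈ Icc 1 Y, χ (d : ZMod q) * ((Real.log d / d : ℝ) : ℂ)) = ∑ d ∈ Icc 1 Y, T d := by
    rw [sum_divisorSum_div_eq_of_le χ hNY, Finset.mul_sum, ← Finset.sum_sub_distrib,
      ← Finset.sum_sub_distrib]
    refine Finset.sum_congr rfl fun d hd => ?_
    rw [mem_Icc] at hd
    have hd0 : (d : ℂ) ≠ 0 := by exact_mod_cast (by omega : d ≠ 0)
    simp only [hT]
    push_cast
    field_simp
    ring
  rw [hdiff]
  -- termwise bounds
  have hterm1 : ∀ d ∈ Icc 1 N, ‖T d‖ ≤ 4 / (N : ℝ) := by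
    intro d hd
    rw [mem_Icc] at hd
    have hd0 : (0 : ℝ) < d := by exact_mod_cast hd.1
    have hH := DirichletAbel.abs_harmonic_div_sub_le hd.1 hd.2
    simp only [hT, norm_mul, norm_div, Complex.norm_natCast]
    rw [← Complex.ofReal_sub, Complex.norm_real, Real.norm_eq_abs]
    calc ‖χ (d : ZMod q)‖ / d * |(harmonic (N / d) : ℝ) -
          (Real.log N - Real.log d + Real.eulerMascheroniConstant)|
        ≤ 1 / d * (4 * (d : ℝ) / N) := by
          gcongr
          exact χ.norm_le_one _
      _ = 4 / N := by field_simp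
  have hterm2 : ∀ d ∈ Icc (N + 1) Y, ‖T d‖ ≤ (1 + Real.log ((Y : ℝ) / N)) * (1 / (d : ℝ)) := by
    intro d hd
    rw [mem_Icc] at hd
    have hd0 : (0 : ℝ) < d := by exact_mod_cast (by omega : 0 < d)
    have hlt : N < d := by omega
    have hdY : (d : ℝ) ≤ Y := by exact_mod_cast hd.2
    simp only [hT, Nat.div_eq_of_lt hlt, harmonic_zero, Rat.cast_zero, Complex.ofReal_zero, zero_sub,
      norm_mul, norm_div, Complex.norm_natCast, norm_neg, Complex.norm_real, Real.norm_eq_abs]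
    have hlogdN : 0 ≤ Real.log d - Real.log N := by
      rw [← Real.log_div hd0.ne' hN0.ne']
      exact Real.log_nonneg ((one_le_div hN0).mpr (by exact_mod_cast hlt.le))
    have hlogdY : Real.log d - Real.log N ≤ Real.log ((Y : ℝ) / N) := by
      rw [Real.log_div hY0.ne' hN0.ne']
      linarith [Real.log_le_log hd0 hdY]
    have habs : |Real.log N - Real.log d + Real.eulerMascheroniConstant| ≤ 1 + Real.log ((Y : ℝ) / N) := by
      rw [abs_le]; constructor <;> linarith
    calc ‖χ (d : ZMod q)‖ / d * |Real.log N - Real.log d + Real.eulerMascheroniConstant|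
        ≤ 1 / d * (1 + Real.log ((Y : ℝ) / N)) := by
          gcongr
          exact χ.norm_le_one _
      _ = (1 + Real.log ((Y : ℝ) / N)) * (1 / (d : ℝ)) := by ring
  -- split the range
  have hsplit : ∑ d ∈ Icc 1 Y, T d = ∑ d ∈ Icc 1 N, T d + ∑ d ∈ Icc (N + 1) Y, T d := by
    have e1 : Icc 1 Y = Ico 1 (Y + 1) := by ext n; simp only [mem_Icc, mem_Ico]; omega
    have e2 : Icc 1 N = Ico 1 (N + 1) := by ext n; simp only [mem_Icc, mem_Ico]; omega
    have e3 : Icc (N + 1) Y = Ico (N + 1) (Y + 1) := by ext n; simp only [mem_Icc, mem_Ico]; omega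
    rw [e1, e2, e3, Finset.sum_Ico_consecutive _ (by omega) (by omega)]
  rw [hsplit]
  refine (norm_add_le _ _).trans (add_le_add ?_ ?_)
  · refine (norm_sum_le _ _).trans ((Finset.sum_le_sum hterm1).trans ?_)
    rw [Finset.sum_const, Nat.card_Icc, nsmul_eq_mul]
    push_cast
    field_simp
    simp
  · refine (norm_sum_le _ _).trans ((Finset.sum_le_sum hterm2).trans ?_)
    rw [← Finset.mul_sum, sq]
    exact mul_le_mul_of_nonneg_left (sum_inv_Icc_le hN hNY) (by linarith)


/-- **The error in the short range (Exercise 3(a),(b),(d) with `y ≥ x`).** For `χ ≠ χ₀` with partial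
sums bounded by `B`, `1 ≤ N ≤ Y`, `2 ≤ Y`:
`|Σ_{n≤N} r(n)/n − ((log N + γ)L(1,χ) + L′(1,χ))| ≤ 2B(log N + 1 + log(Y+1))/(Y+1) + 4 + (1 + log(Y/N))²`.
[cite: MontgomeryVaughan2007, §11.2.1 Exercise 3(d)] -/
theorem norm_sub_main_le_of_le (hχ : χ ≠ 1) {B : ℝ} (hB : ∀ n, ‖DirichletAbel.partialSum χ n‖ ≤ B)
    {N Y : ℕ} (hN : 1 ≤ N) (hNY : N ≤ Y) (hY : 2 ≤ Y) :
    ‖(∑ n ∈ Icc 1 N, (∑ d ∈ n.divisors, χ (d : ZMod q)) / (n : ℂ)) -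
        (((Real.log N + Real.eulerMascheroniConstant : ℝ) : ℂ) * χ.LFunction 1 +
          deriv χ.LFunction 1)‖ ≤
      2 * B * (Real.log N + 1 + Real.log ((Y : ℝ) + 1)) / ((Y : ℝ) + 1) + 4 +
        (1 + Real.log ((Y : ℝ) / N)) ^ 2 := by
  have hB0 : 0 ≤ B := (norm_nonneg _).trans (hB 0)
  have hN0 : (0 : ℝ) < N := by exact_mod_cast hN
  have hlogN : 0 ≤ Real.log N := Real.log_nonneg (by exact_mod_cast hN)
  have hγ0 : 0 ≤ Real.eulerMascheroniConstant :=
    (by norm_num : (0 : ℝ) ≤ 1 / 2).trans Real.one_half_lt_eulerMascheroniConstant.le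
  have hγ1 : Real.eulerMascheroniConstant ≤ 1 :=
    (Real.eulerMascheroniConstant_lt_two_thirds.le).trans (by norm_num)
  have hY1 : (0 : ℝ) < (Y : ℝ) + 1 := by positivity
  have hlogY : 0 ≤ Real.log ((Y : ℝ) + 1) := Real.log_nonneg (by linarith)
  set S : ℂ := ∑ n ∈ Icc 1 N, (∑ d ∈ n.divisors, χ (d : ZMod q)) / (n : ℂ) with hS
  set A : ℂ := ∑ d ∈ Icc 1 Y, χ (d : ZMod q) / (d : ℂ) with hA
  set D : ℂ := ∑ d ∈ Icc 1 Y, χ (d : ZMod q) * ((Real.log d / d : ℝ) : ℂ) with hD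
  set c : ℝ := Real.log N + Real.eulerMascheroniConstant with hc
  have hc0 : 0 ≤ c := add_nonneg hlogN hγ0
  have e0 := norm_sub_head_le_of_le χ hN hNY
  have e1 := DirichletAbel.norm_sum_Icc_div_sub_LFunction_one_le χ hχ hB Y
  have e2 := DirichletAbel.norm_sum_Icc_log_div_add_deriv_le χ hχ hB hY
  rw [← hS, ← hA, ← hD] at *
  have hdecomp : S - (((c : ℝ) : ℂ) * χ.LFunction 1 + deriv χ.LFunction 1) =
      (S - ((c : ℂ) * A - D)) + (c : ℂ) * (A - χ.LFunction 1) - (D + deriv χ.LFunction 1) := by ring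
  rw [hdecomp]
  have h1 : ‖(c : ℂ) * (A - χ.LFunction 1)‖ ≤ c * (2 * B / ((Y : ℝ) + 1)) := by
    rw [norm_mul, Complex.norm_real, Real.norm_eq_abs, abs_of_nonneg hc0]
    exact mul_le_mul_of_nonneg_left e1 hc0
  calc ‖(S - ((c : ℂ) * A - D)) + (c : ℂ) * (A - χ.LFunction 1) - (D + deriv χ.LFunction 1)‖
      ≤ ‖S - ((c : ℂ) * A - D)‖ + ‖(c : ℂ) * (A - χ.LFunction 1)‖ + ‖D + deriv χ.LFunction 1‖ :=
        (norm_sub_le _ _).trans (add_le_add (norm_add_le _ _) le_rfl)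
    _ ≤ (4 + (1 + Real.log ((Y : ℝ) / N)) ^ 2) + c * (2 * B / ((Y : ℝ) + 1)) +
          2 * B * (Real.log ((Y : ℝ) + 1) / ((Y : ℝ) + 1)) := add_le_add (add_le_add e0 h1) e2
    _ ≤ (4 + (1 + Real.log ((Y : ℝ) / N)) ^ 2) + (Real.log N + 1) * (2 * B / ((Y : ℝ) + 1)) +
          2 * B * (Real.log ((Y : ℝ) + 1) / ((Y : ℝ) + 1)) := by
        gcongr; rw [hc]; linarith
    _ = 2 * B * (Real.log N + 1 + Real.log ((Y : ℝ) + 1)) / ((Y : ℝ) + 1) + 4 +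
          (1 + Real.log ((Y : ℝ) / N)) ^ 2 := by
        field_simp; ring

omit [NeZero q] in
/-- `√(√q) = q^{1/4}`. [folklore] -/
private theorem sqrt_sqrt_eq_rpow : Real.sqrt (Real.sqrt q) = (q : ℝ) ^ (1 / 4 : ℝ) := by
  rw [Real.sqrt_eq_rpow, Real.sqrt_eq_rpow, ← Real.rpow_mul (Nat.cast_nonneg q)]
  norm_num

set_option maxHeartbeats 400000 in
/-- **The mean value with both ranges joined**, `N`-version: for `χ ≠ χ₀` mod `q` and `N ≥ 1`,
`√N · |Σ_{n≤N} r(n)/n − ((log N + γ)L(1,χ) + L′(1,χ))| ≤ 320 q^{1/4} log(qN)`.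
(Long range `N ≥ B(1 + log N)`, `B = 8√q(1+log q)`: the tree's two-sided hyperbola estimate
`DirichletAbel.norm_sum_divisorSum_div_sub_le` with `Y = ⌊√(BN(1+log N))⌋`; short range: the head taken
to `Y = N + ⌈B(1 + log qN)⌉ > N`, `norm_sub_main_le_of_le`.)
[cite: MontgomeryVaughan2007, §11.2.1 Exercise 3(g)] -/
theorem norm_sub_main_mul_sqrt_le (hχ : χ ≠ 1) {N : ℕ} (hN : 1 ≤ N) :
    ‖(∑ n ∈ Icc 1 N, (∑ d ∈ n.divisors, χ (d : ZMod q)) / (n : ℂ)) -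
        (((Real.log N + Real.eulerMascheroniConstant : ℝ) : ℂ) * χ.LFunction 1 +
          deriv χ.LFunction 1)‖ * Real.sqrt N ≤
      320 * (q : ℝ) ^ (1 / 4 : ℝ) * Real.log ((q : ℝ) * N) := by
  -- sizes
  have hq3 : (3 : ℝ) ≤ q := by exact_mod_cast three_le χ hχ
  have hq0 : (0 : ℝ) < q := by linarith
  have hN0 : (0 : ℝ) < N := by exact_mod_cast hN
  have hN1 : (1 : ℝ) ≤ N := by exact_mod_cast hN
  set a : ℝ := Real.log q with ha
  set b : ℝ := Real.log N with hb
  have ha1 : 1 ≤ a := by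
    rw [ha, ← Real.log_exp 1]
    refine Real.log_le_log (Real.exp_pos 1) (le_trans ?_ hq3)
    have := Real.exp_one_lt_d9; norm_num at this; linarith
  have hb0 : 0 ≤ b := Real.log_nonneg hN1
  have hab : Real.log ((q : ℝ) * N) = a + b := Real.log_mul hq0.ne' hN0.ne'
  rw [hab, ← sqrt_sqrt_eq_rpow]
  have hsq3 : (17 / 10 : ℝ) ≤ Real.sqrt q :=
    Real.le_sqrt_of_sq_le (by nlinarith)
  have hsq0 : 0 < Real.sqrt q := by linarith
  have hQ0 : 0 < Real.sqrt (Real.sqrt q) := Real.sqrt_pos.mpr hsq0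
  -- the Pólya–Vinogradov constant
  set B : ℝ := 8 * (Real.sqrt q * (1 + a)) with hBdef
  have hB : ∀ n, ‖DirichletAbel.partialSum χ n‖ ≤ B := norm_partialSum_le_pv χ hχ
  have hB27 : 27 ≤ B := by rw [hBdef]; nlinarith
  have hB0 : 0 < B := by linarith
  -- the common majorant `32 √q (a+b)²` and its square root
  set W : ℝ := Real.sqrt q * (a + b) ^ 2 with hW
  have hab1 : 1 ≤ a + b := by linarith
  have h1a : 1 + a ≤ 2 * (a + b) := by linarith
  have h1b : 1 + b ≤ 2 * (a + b) := by linarith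
  have hW1 : B * (1 + b) ≤ 32 * W := by
    rw [hBdef, hW]
    have : (1 + a) * (1 + b) ≤ 4 * (a + b) ^ 2 := by nlinarith
    nlinarith [Real.sqrt_nonneg (q : ℝ)]
  have hW2 : B * (1 + a + b) ≤ 32 * W := by
    rw [hBdef, hW]
    have : (1 + a) * (1 + a + b) ≤ 4 * (a + b) ^ 2 := by nlinarith
    nlinarith [Real.sqrt_nonneg (q : ℝ)]
  have hsqrtW : Real.sqrt (32 * W) ≤ 6 * Real.sqrt (Real.sqrt q) * (a + b) := by
    rw [Real.sqrt_le_left (by positivity)]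
    have hQ2 : Real.sqrt (Real.sqrt q) ^ 2 = Real.sqrt q := Real.sq_sqrt (Real.sqrt_nonneg _)
    calc 32 * W = 32 * Real.sqrt (Real.sqrt q) ^ 2 * (a + b) ^ 2 := by rw [hQ2, hW]; ring
      _ ≤ 36 * Real.sqrt (Real.sqrt q) ^ 2 * (a + b) ^ 2 := by gcongr; norm_num
      _ = (6 * Real.sqrt (Real.sqrt q) * (a + b)) ^ 2 := by ring
  -- the quantity to bound
  set E : ℝ := ‖(∑ n ∈ Icc 1 N, (∑ d ∈ n.divisors, χ (d : ZMod q)) / (n : ℂ)) -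
        (((Real.log N + Real.eulerMascheroniConstant : ℝ) : ℂ) * χ.LFunction 1 +
          deriv χ.LFunction 1)‖ with hE
  have hE0 : 0 ≤ E := norm_nonneg _
  clear_value a b B W E
  by_cases hreg : B * (1 + b) ≤ N
  · /- the long range: two-sided hyperbola method with `Y = ⌊√(BN(1+log N))⌋` -/
    set s : ℝ := Real.sqrt (B * N * (1 + b)) with hs
    have hs0 : 0 ≤ s := Real.sqrt_nonneg _
    have hs2 : s ^ 2 = B * N * (1 + b) := Real.sq_sqrt (by positivity)
    have hsN : s ≤ N := by
      rw [hs, Real.sqrt_le_left hN0.le]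
      nlinarith
    have hs4 : 2 ≤ s := by
      rw [hs]; refine Real.le_sqrt_of_sq_le ?_
      have h27 : 27 * 1 ≤ B * N := mul_le_mul hB27 hN1 zero_le_one hB0.le
      nlinarith [mul_nonneg (mul_nonneg hB0.le hN0.le) hb0]
    have hspos : 0 < s := by linarith
    set Y : ℕ := ⌊s⌋₊ with hY
    clear_value s Y
    have hYle : (Y : ℝ) ≤ s := hY ▸ Nat.floor_le hs0
    have hYge : s ≤ (Y : ℝ) + 1 := hY ▸ (Nat.lt_floor_add_one s).le
    have hY2 : 2 ≤ Y := hY ▸ Nat.le_floor (by exact_mod_cast hs4)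
    have hYN : Y ≤ N := by exact_mod_cast hYle.trans hsN
    have h := DirichletAbel.norm_sum_divisorSum_div_sub_le χ hχ hB hY2 hYN
    rw [← hE, ← hb] at h
    -- `E ≤ 8B(1+b)/s + 4s/N = 12 s/N`
    have hE1 : E ≤ 12 * s / N := by
      have hkey : B * (b + 1) = s ^ 2 / N := by rw [hs2]; field_simp; ring
      calc E ≤ 8 * B * (b + 1) / ((Y : ℝ) + 1) + 4 * (Y : ℝ) / N := h
        _ ≤ 8 * B * (b + 1) / s + 4 * s / N := by gcongr
        _ = 8 * (B * (b + 1)) / s + 4 * s / N := by ring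
        _ = 12 * s / N := by rw [hkey]; field_simp; ring
    -- `E √N ≤ 12 s/√N = 12 √(B(1+b)) ≤ 12 √(32 W)`
    have hsqN : Real.sqrt N ^ 2 = N := Real.sq_sqrt hN0.le
    have hsqN0 : 0 < Real.sqrt N := Real.sqrt_pos.mpr hN0
    have hs' : s = Real.sqrt N * Real.sqrt (B * (1 + b)) := by
      rw [hs, ← Real.sqrt_mul hN0.le]; congr 1; ring
    have hX0 : 0 ≤ Real.sqrt (Real.sqrt q) * (a + b) := by positivity
    calc E * Real.sqrt N ≤ 12 * s / N * Real.sqrt N := by gcongr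
      _ = 12 * Real.sqrt (B * (1 + b)) * (Real.sqrt N * Real.sqrt N / N) := by rw [hs']; ring
      _ = 12 * Real.sqrt (B * (1 + b)) := by
          rw [Real.mul_self_sqrt hN0.le, div_self hN0.ne', mul_one]
      _ ≤ 12 * Real.sqrt (32 * W) := mul_le_mul_of_nonneg_left (Real.sqrt_le_sqrt hW1) (by norm_num)
      _ ≤ 12 * (6 * Real.sqrt (Real.sqrt q) * (a + b)) := mul_le_mul_of_nonneg_left hsqrtW (by norm_num)
      _ = 72 * (Real.sqrt (Real.sqrt q) * (a + b)) := by ring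
      _ ≤ 320 * (Real.sqrt (Real.sqrt q) * (a + b)) := mul_le_mul_of_nonneg_right (by norm_num) hX0
      _ = 320 * Real.sqrt (Real.sqrt q) * (a + b) := by ring
  · /- the short range: the head taken to `Y = N + ⌈B(1 + a + b)⌉ > N` -/
    have hreg' : (N : ℝ) < B * (1 + b) := lt_of_not_ge hreg
    set L : ℝ := 1 + a + b with hL
    have hL2 : 2 ≤ L := by linarith
    have hBL : 54 ≤ B * L := by nlinarith
    have hNBL : (N : ℝ) ≤ B * L := by
      refine hreg'.le.trans ?_
      rw [hL]; nlinarith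
    set Y : ℕ := N + ⌈B * L⌉₊ with hY
    clear_value L Y
    have hNY : N ≤ Y := hY ▸ Nat.le_add_right _ _
    have hYge : B * L ≤ (Y : ℝ) + 1 := by
      have := Nat.le_ceil (B * L)
      rw [hY]; push_cast; linarith
    have hYle : (Y : ℝ) + 1 ≤ 3 * (B * L) := by
      have := Nat.ceil_lt_add_one (show 0 ≤ B * L by positivity)
      rw [hY]; push_cast; linarith
    have hY2 : 2 ≤ Y := by
      have : (2 : ℝ) ≤ Y := by linarith
      exact_mod_cast this
    have hY0 : (0 : ℝ) < Y := by exact_mod_cast (by omega : 0 < Y)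
    have h := norm_sub_main_le_of_le χ hχ hB hN hNY hY2
    rw [← hE, ← hb] at h
    -- `log(Y+1) ≤ log(3BL) ≤ 6(a+b)`
    have hlog2 : Real.log 2 < 0.6932 := Real.log_two_lt_d9.trans (by norm_num)
    have hlog8 : Real.log 8 ≤ 2.1 := by
      rw [show (8 : ℝ) = 2 ^ 3 by norm_num, Real.log_pow]; push_cast; linarith
    have hlog3 : Real.log 3 ≤ 2 := by
      have := Real.log_le_sub_one_of_pos (show (0 : ℝ) < 3 by norm_num); linarith
    have hlogY1 : Real.log ((Y : ℝ) + 1) ≤ 7 * (a + b) := by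
      have hpos : 0 < (Y : ℝ) + 1 := by linarith only [hY0]
      have e1 : Real.log ((Y : ℝ) + 1) ≤ Real.log (3 * (B * L)) := Real.log_le_log hpos hYle
      have e2 : Real.log (3 * (B * L)) = Real.log 3 + (Real.log 8 + (Real.log (Real.sqrt q) +
          Real.log (1 + a))) + Real.log L := by
        rw [Real.log_mul (by norm_num) (by positivity), Real.log_mul hB0.ne' (by positivity), hBdef,
          Real.log_mul (by norm_num) (by positivity), Real.log_mul hsq0.ne' (by positivity)]
        ring
      have e3 : Real.log (Real.sqrt q) = a / 2 := by rw [Real.log_sqrt hq0.le, ha]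
      have e4 : Real.log (1 + a) ≤ a := by
        have := Real.log_le_sub_one_of_pos (show 0 < 1 + a by linarith only [ha1])
        linarith only [this]
      have e5 : Real.log L ≤ a + b := by
        have := Real.log_le_sub_one_of_pos (show 0 < L by linarith only [hL2])
        rw [hL] at this ⊢
        linarith only [this]
      rw [e2, e3] at e1
      linarith only [e1, hlog3, hlog8, e4, e5, ha1, hb0]
    -- `E ≤ 20 + (1 + log(Y/N))²`
    have hE1 : E ≤ 20 + (1 + Real.log ((Y : ℝ) / N)) ^ 2 := by
      have hnum : b + 1 + Real.log ((Y : ℝ) + 1) ≤ 8 * L := by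
        rw [hL]; linarith only [hlogY1, ha1, hb0]
      have hfrac : 2 * B * (b + 1 + Real.log ((Y : ℝ) + 1)) / ((Y : ℝ) + 1) ≤ 16 := by
        rw [div_le_iff₀ (by linarith only [hY0])]
        calc 2 * B * (b + 1 + Real.log ((Y : ℝ) + 1)) ≤ 2 * B * (8 * L) :=
              mul_le_mul_of_nonneg_left hnum (by linarith only [hB0])
          _ = 16 * (B * L) := by ring
          _ ≤ 16 * ((Y : ℝ) + 1) := by linarith only [hYge]
      linarith only [h, hfrac]
    -- `(1 + log(Y/N))² ≤ 16 √(Y/N)`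
    have hYN1 : 1 ≤ (Y : ℝ) / N := (one_le_div hN0).mpr (by exact_mod_cast hNY)
    have hE2 : E ≤ 20 + 16 * Real.sqrt ((Y : ℝ) / N) := by
      linarith only [hE1, one_add_log_sq_le hYN1]
    -- `E √N ≤ 20 √N + 16 √Y ≤ 48 √(BL) ≤ 48 √(32 W)`
    have hsqN0 : 0 ≤ Real.sqrt N := Real.sqrt_nonneg _
    have hsqYN : Real.sqrt ((Y : ℝ) / N) * Real.sqrt N = Real.sqrt Y := by
      rw [← Real.sqrt_mul (by positivity), div_mul_cancel₀ _ hN0.ne']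
    have hsqN_le : Real.sqrt N ≤ Real.sqrt (B * L) := Real.sqrt_le_sqrt hNBL
    have hsqY_le : Real.sqrt Y ≤ 2 * Real.sqrt (B * L) := by
      have h4 : Real.sqrt 4 = 2 := by
        rw [show (4 : ℝ) = 2 ^ 2 by norm_num, Real.sqrt_sq (by norm_num : (0 : ℝ) ≤ 2)]
      calc Real.sqrt Y ≤ Real.sqrt (4 * (B * L)) := Real.sqrt_le_sqrt (by linarith only [hYle, hBL])
        _ = 2 * Real.sqrt (B * L) := by rw [Real.sqrt_mul (by norm_num : (0 : ℝ) ≤ 4), h4]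
    have hBLW : Real.sqrt (B * L) ≤ Real.sqrt (32 * W) := Real.sqrt_le_sqrt hW2
    have hX0 : 0 ≤ Real.sqrt (Real.sqrt q) * (a + b) := by positivity
    calc E * Real.sqrt N ≤ (20 + 16 * Real.sqrt ((Y : ℝ) / N)) * Real.sqrt N :=
          mul_le_mul_of_nonneg_right hE2 hsqN0
      _ = 20 * Real.sqrt N + 16 * Real.sqrt Y := by rw [← hsqYN]; ring
      _ ≤ 20 * Real.sqrt (B * L) + 16 * (2 * Real.sqrt (B * L)) :=
          add_le_add (mul_le_mul_of_nonneg_left hsqN_le (by norm_num))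
            (mul_le_mul_of_nonneg_left hsqY_le (by norm_num))
      _ = 52 * Real.sqrt (B * L) := by ring
      _ ≤ 52 * Real.sqrt (32 * W) := mul_le_mul_of_nonneg_left hBLW (by norm_num)
      _ ≤ 52 * (6 * Real.sqrt (Real.sqrt q) * (a + b)) := mul_le_mul_of_nonneg_left hsqrtW (by norm_num)
      _ = 312 * (Real.sqrt (Real.sqrt q) * (a + b)) := by ring
      _ ≤ 320 * (Real.sqrt (Real.sqrt q) * (a + b)) := mul_le_mul_of_nonneg_right (by norm_num) hX0
      _ = 320 * Real.sqrt (Real.sqrt q) * (a + b) := by ring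


omit [NeZero q] in
/-- Real parts: `Re Σ_{n≤N} λ(n)/n = Σ_{n≤N} r(n)/n` with `r = rDivisorSum χ` (`r(n) = Σ_{d∣n} Re χ(d)`).
[cite: MontgomeryVaughan2007, §11.2.1 Exercise 3 p. 286] -/
theorem re_sum_divisorSum_div (N : ℕ) :
    (∑ n ∈ Icc 1 N, (∑ d ∈ n.divisors, χ (d : ZMod q)) / (n : ℂ)).re =
      ∑ n ∈ Icc 1 N, rDivisorSum χ n / (n : ℝ) := by
  rw [Complex.re_sum]
  refine Finset.sum_congr rfl fun n _ => ?_
  rw [Complex.div_natCast_re, Complex.re_sum, rDivisorSum]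

/-- **Exercise 3(g) with the logarithm to the first power** (what the proof gives): for every
non-principal `χ` mod `q` and real `x ≥ 1`,
`|Σ_{n ≤ x} r(n)/n − ((log x + γ) Re L(1,χ) + Re L′(1,χ))| ≤ 500 q^{1/4} x^{−1/2} log(qx)`.
[cite: MontgomeryVaughan2007, §11.2.1 Exercise 3(g) p. 286] -/
theorem abs_sum_rDivisorSum_div_sub_le (hχ : χ ≠ 1) {x : ℝ} (hx : 1 ≤ x) :
    |(∑ n ∈ Finset.Icc 1 ⌊x⌋₊, rDivisorSum χ n / (n : ℝ)) -
        ((Real.log x + Real.eulerMascheroniConstant) * (χ.LFunction 1).re +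
          (deriv χ.LFunction 1).re)| ≤
      500 * (q : ℝ) ^ (1 / 4 : ℝ) * x ^ (-(1 / 2 : ℝ)) * Real.log ((q : ℝ) * x) := by
  have hq3 : (3 : ℝ) ≤ q := by exact_mod_cast three_le χ hχ
  have hq0 : (0 : ℝ) < q := by linarith
  have hx0 : 0 < x := by linarith
  -- `N = ⌊x⌋`
  set N : ℕ := ⌊x⌋₊ with hNdef
  have hN : 1 ≤ N := hNdef ▸ Nat.le_floor (by exact_mod_cast hx)
  have hNx : (N : ℝ) ≤ x := hNdef ▸ Nat.floor_le hx0.le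
  have hxN : x < (N : ℝ) + 1 := hNdef ▸ Nat.lt_floor_add_one x
  clear_value N
  have hN0 : (0 : ℝ) < N := by exact_mod_cast hN
  have hN1 : (1 : ℝ) ≤ N := by exact_mod_cast hN
  -- logarithms
  have hlogq : 1 ≤ Real.log q := by
    rw [← Real.log_exp 1]
    refine Real.log_le_log (Real.exp_pos 1) (le_trans ?_ hq3)
    have := Real.exp_one_lt_d9; norm_num at this; linarith
  have hlogN : 0 ≤ Real.log N := Real.log_nonneg hN1
  have hlogqN : Real.log ((q : ℝ) * N) = Real.log q + Real.log N := Real.log_mul hq0.ne' hN0.ne'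
  have hlogqx : Real.log ((q : ℝ) * N) ≤ Real.log ((q : ℝ) * x) :=
    Real.log_le_log (by positivity) (by gcongr)
  have hlogqN1 : 1 ≤ Real.log ((q : ℝ) * N) := by rw [hlogqN]; linarith
  have hlogxN0 : 0 ≤ Real.log x - Real.log N := by
    linarith [Real.log_le_log hN0 hNx]
  have hlogxN : Real.log x - Real.log N ≤ 1 / N := by
    rw [← Real.log_div hx0.ne' hN0.ne']
    have := Real.log_le_sub_one_of_pos (show 0 < x / N by positivity)
    have h2 : x / N - 1 ≤ 1 / N := by
      rw [div_sub_one hN0.ne', div_le_div_iff_of_pos_right hN0]; linarith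
    linarith
  -- the complex mean value and its real part
  set S : ℂ := ∑ n ∈ Icc 1 N, (∑ d ∈ n.divisors, χ (d : ZMod q)) / (n : ℂ) with hS
  set M : ℂ := ((Real.log N + Real.eulerMascheroniConstant : ℝ) : ℂ) * χ.LFunction 1 +
    deriv χ.LFunction 1 with hM
  have hmain := norm_sub_main_mul_sqrt_le χ hχ hN
  rw [← hS, ← hM] at hmain
  have hreS : S.re = ∑ n ∈ Icc 1 N, rDivisorSum χ n / (n : ℝ) := by
    rw [hS]; exact re_sum_divisorSum_div χ N
  have hreM : M.re = (Real.log N + Real.eulerMascheroniConstant) * (χ.LFunction 1).re +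
      (deriv χ.LFunction 1).re := by
    rw [hM, Complex.add_re, Complex.re_ofReal_mul]
  have hL1 : |(χ.LFunction 1).re| ≤ 3 + Real.log q :=
    (Complex.abs_re_le_norm _).trans (norm_LFunction_one_le_log χ hχ)
  -- the real-part identity
  have hid : (∑ n ∈ Icc 1 N, rDivisorSum χ n / (n : ℝ)) -
      ((Real.log x + Real.eulerMascheroniConstant) * (χ.LFunction 1).re + (deriv χ.LFunction 1).re) =
      (S - M).re - (Real.log x - Real.log N) * (χ.LFunction 1).re := by
    rw [Complex.sub_re, hreS, hreM]; ring
  rw [hid]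
  -- `|…| ≤ ‖S − M‖ + (1/N)(3 + log q)`
  have hsqN0 : 0 < Real.sqrt N := Real.sqrt_pos.mpr hN0
  have hsqN1 : 1 ≤ Real.sqrt N := by rw [← Real.sqrt_one]; exact Real.sqrt_le_sqrt hN1
  have hsqNN : Real.sqrt N ≤ N := by
    rw [Real.sqrt_le_left hN0.le]; nlinarith
  set Q4 : ℝ := (q : ℝ) ^ (1 / 4 : ℝ) with hQ4
  have hQ41 : 1 ≤ Q4 := Real.one_le_rpow (by linarith) (by norm_num)
  have hE : ‖S - M‖ ≤ 320 * Q4 * Real.log ((q : ℝ) * N) / Real.sqrt N := by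
    rw [le_div_iff₀ hsqN0]; exact hmain
  have hlogqx0 : 0 ≤ Real.log ((q : ℝ) * x) := by linarith
  have h34 : 3 + Real.log q ≤ 4 * Q4 * Real.log ((q : ℝ) * N) := by
    rw [hlogqN]
    nlinarith [mul_nonneg (sub_nonneg.mpr hQ41) (add_nonneg (zero_le_one.trans hlogq) hlogN)]
  have h2 : |(Real.log x - Real.log N) * (χ.LFunction 1).re| ≤
      4 * Q4 * Real.log ((q : ℝ) * N) / Real.sqrt N := by
    rw [abs_mul, abs_of_nonneg hlogxN0]
    calc (Real.log x - Real.log N) * |(χ.LFunction 1).re| ≤ 1 / N * (3 + Real.log q) :=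
          mul_le_mul hlogxN hL1 (abs_nonneg _) (by positivity)
      _ ≤ 1 / Real.sqrt N * (4 * Q4 * Real.log ((q : ℝ) * N)) :=
          mul_le_mul (one_div_le_one_div_of_le hsqN0 hsqNN) h34 (by positivity) (by positivity)
      _ = 4 * Q4 * Real.log ((q : ℝ) * N) / Real.sqrt N := by ring
  have h3 : |(S - M).re - (Real.log x - Real.log N) * (χ.LFunction 1).re| ≤
      324 * Q4 * Real.log ((q : ℝ) * N) / Real.sqrt N := by
    calc |(S - M).re - (Real.log x - Real.log N) * (χ.LFunction 1).re|
        ≤ |(S - M).re| + |(Real.log x - Real.log N) * (χ.LFunction 1).re| := abs_sub _ _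
      _ ≤ 320 * Q4 * Real.log ((q : ℝ) * N) / Real.sqrt N +
            4 * Q4 * Real.log ((q : ℝ) * N) / Real.sqrt N :=
          add_le_add ((Complex.abs_re_le_norm _).trans hE) h2
      _ = 324 * Q4 * Real.log ((q : ℝ) * N) / Real.sqrt N := by ring
  refine h3.trans ?_
  -- `1/√N ≤ √2/√x ≤ (3/2)/√x`, `log(qN) ≤ log(qx) ≤ (log qx)^{3/2}`, `x^{-1/2} = 1/√x`
  have hsqx0 : 0 < Real.sqrt x := Real.sqrt_pos.mpr hx0
  have hsqx : Real.sqrt x ≤ Real.sqrt 2 * Real.sqrt N := by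
    rw [← Real.sqrt_mul (by norm_num : (0 : ℝ) ≤ 2)]
    exact Real.sqrt_le_sqrt (by linarith)
  have hsq2 : Real.sqrt 2 ≤ 3 / 2 := by
    rw [Real.sqrt_le_left (by norm_num)]; norm_num
  have hrpow : x ^ (-(1 / 2 : ℝ)) = 1 / Real.sqrt x := by
    rw [Real.rpow_neg hx0.le, Real.sqrt_eq_rpow, one_div, one_div]
  have hQ40 : 0 ≤ Q4 := by linarith
  have hB1 : Real.log ((q : ℝ) * N) * (1 / Real.sqrt N) ≤
      Real.log ((q : ℝ) * x) * ((3 / 2) / Real.sqrt x) := by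
    refine mul_le_mul hlogqx ?_ (by positivity) hlogqx0
    rw [div_le_div_iff₀ hsqN0 hsqx0]
    nlinarith [hsqx, hsq2, hsqN0.le, Real.sqrt_nonneg (2 : ℝ)]
  rw [hrpow]
  calc 324 * Q4 * Real.log ((q : ℝ) * N) / Real.sqrt N
      = (324 * Q4) * (Real.log ((q : ℝ) * N) * (1 / Real.sqrt N)) := by ring
    _ ≤ (324 * Q4) * (Real.log ((q : ℝ) * x) * ((3 / 2) / Real.sqrt x)) :=
        mul_le_mul_of_nonneg_left hB1 (by positivity)
    _ = 486 * (Q4 * (1 / Real.sqrt x) * Real.log ((q : ℝ) * x)) := by ring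
    _ ≤ 500 * (Q4 * (1 / Real.sqrt x) * Real.log ((q : ℝ) * x)) :=
        mul_le_mul_of_nonneg_right (by norm_num) (by positivity)
    _ = 500 * Q4 * (1 / Real.sqrt x) * Real.log ((q : ℝ) * x) := by ring

end MontgomeryVaughan2007Ex3

open MontgomeryVaughan2007Ex3 in
/-- **Montgomery–Vaughan I, §11.2.1 Exercise 3(g) — DISCHARGED:** there is an absolute `c` (here
`c = 500`) such that for every non-principal quadratic `χ` mod `q` and every real `x ≥ 1`,
`|Σ_{n ≤ x} r(n)/n − ((log x + C₀)L(1,χ) + L′(1,χ))| ≤ c q^{1/4} x^{−1/2} (log qx)^{3/2}`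
(from `abs_sum_rDivisorSum_div_sub_le`, `log(qx) ≤ (log qx)^{3/2}` as `log(qx) ≥ log 3 > 1`; the
hypothesis "quadratic" is not used). [cite: MontgomeryVaughan2007, §11.2.1 Exercise 3(g) p. 286] -/
theorem montgomeryVaughan2007_ex11_2_1_3g_holds : montgomeryVaughan2007_ex11_2_1_3g := by
  refine ⟨500, fun q _ χ hχ _ x hx => ?_⟩
  have h := abs_sum_rDivisorSum_div_sub_le χ hχ hx
  refine h.trans ?_
  have hq3 : (3 : ℝ) ≤ q := by exact_mod_cast three_le χ hχ
  have hx0 : 0 < x := by linarith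
  have hlog1 : 1 ≤ Real.log ((q : ℝ) * x) := by
    rw [← Real.log_exp 1]
    refine Real.log_le_log (Real.exp_pos 1) ?_
    have := Real.exp_one_lt_d9; norm_num at this; nlinarith
  have hlog32 : Real.log ((q : ℝ) * x) ≤ Real.log ((q : ℝ) * x) ^ (3 / 2 : ℝ) := by
    calc Real.log ((q : ℝ) * x) = Real.log ((q : ℝ) * x) ^ (1 : ℝ) := (Real.rpow_one _).symm
      _ ≤ Real.log ((q : ℝ) * x) ^ (3 / 2 : ℝ) :=
          Real.rpow_le_rpow_of_exponent_le hlog1 (by norm_num)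
  have h0 : 0 ≤ 500 * (q : ℝ) ^ (1 / 4 : ℝ) * x ^ (-(1 / 2 : ℝ)) := by positivity
  exact mul_le_mul_of_nonneg_left hlog32 h0

end Literature.NumberTheory.LFunctions
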